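import Literature.Computability.FineGrained.DTWOVGadgets
import HarnessLib

/-!
# The DTW instance of an OV instance in closed form (for the word-RAM program)

Position-by-position description of the two curves `ovX I`, `ovY I` of
`Literature.Computability.FineGrained.DTWOVGadgets` (the reduction from Orthogonal Vectors to
one-dimensional DTW after K. Bringmann, M. Künnemann, FOCS 2015, §3.1 / §6) by arithmetic decoding
of the position — exactly what the instance-writing word-RAM program computes with `div`/`mod`:

* `getElem_ga`: the `p`-th point of an alignment-gadget curve `ga M κ Xs` with gadgets of a common
  length `ℓ` is `M` if `p < κ`, and otherwise, with `p' = p - κ = k (ℓ + κ) + r`, the point `r` of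
  gadget `k` if `r < ℓ` and `M` if `r ≥ ℓ`;
* `getElem_vgX` / `getElem_vgY`: the `q`-th point of a vector gadget at base height `0` is
  `6 q +` the coordinate value of bit `q / 2` (complemented / neutral at odd `q`);
* `ovXval I p`, `ovYval I q` (natural numbers) and `getElem_ovX`, `getElem_ovY`;
* the emulated input `dtwInput I = |x| :: encodeIntList (x ++ y)` (the `DTW c` encoding of
  `ovDTWInst`), its cells `dtwInput_getD`, and its input width `inputWidth (dtwInput I) =
  Nat.size |dtwInput I|` (`inputWidth_dtwInput`), which fixes the emulated word size.
-/

namespace Literature.Computability.FineGrained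

open Cryptography Cryptography.WordRAM

namespace DTWRed

/-! ### Points of an alignment-gadget curve -/

/-- **The points of `ga M κ Xs` by arithmetic decoding** (all gadgets of length `ℓ`): for
`p < |ga M κ Xs|`, the point is `M` in the leading block; otherwise write `p - κ = k (ℓ + κ) + r`
with `r < ℓ + κ`: it is `X_k[r]` if `r < ℓ` and `M` otherwise. [folklore] -/
theorem getElem_ga (M : ℤ) {κ : ℕ} (hκ : 1 ≤ κ) (ℓ : ℕ) : ∀ (Xs : List (List ℤ)) (hℓ : ∀ X ∈ Xs, X.length = ℓ)
    (p : ℕ) (hp : p < (ga M κ Xs).length),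
    (ga M κ Xs)[p] = if p < κ then M else
      if h : (p - κ) % (ℓ + κ) < ℓ ∧ (p - κ) / (ℓ + κ) < Xs.length then
        (Xs[(p - κ) / (ℓ + κ)])[(p - κ) % (ℓ + κ)]'(by rw [hℓ _ (List.getElem_mem h.2)]; exact h.1)
      else M
  | [], _, p, hp => by
    simp only [ga_nil, List.length_replicate] at hp
    simp [hp]
  | X :: Xs, hℓ, p, hp => by
    have hX : X.length = ℓ := hℓ X (by simp)
    have hℓ' : ∀ Y ∈ Xs, Y.length = ℓ := fun Y hY => hℓ Y (by simp [hY])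
    rw [List.getElem_of_eq (ga_cons M κ X Xs)]
    by_cases h1 : p < κ
    · rw [if_pos h1, List.getElem_append_left (by simp; omega), List.getElem_append_left (by simpa),
        List.getElem_replicate]
    rw [if_neg h1]
    by_cases h2 : p < κ + ℓ
    · -- inside the first gadget
      have hr : (p - κ) % (ℓ + κ) = p - κ := Nat.mod_eq_of_lt (by omega)
      have hk : (p - κ) / (ℓ + κ) = 0 := Nat.div_eq_of_lt (by omega)
      rw [List.getElem_append_left (by simp [hX]; omega), List.getElem_append_right (by simp; omega)]
      simp only [List.length_replicate, hr, hk, List.length_cons, Nat.zero_lt_succ, and_true,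
        List.getElem_cons_zero]
      rw [dif_pos (by omega)]
    · -- in the rest: shift by `κ + ℓ`
      have hlen : (List.replicate κ M ++ X).length = κ + ℓ := by simp [hX]
      have hp' : p - (κ + ℓ) < (ga M κ Xs).length := by
        have e : (ga M κ (X :: Xs)).length = (κ + ℓ) + (ga M κ Xs).length := by
          rw [ga_cons, List.length_append, hlen]
        omega
      rw [List.getElem_append_right (by rw [hlen]; omega)]
      simp only [hlen]
      rw [getElem_ga M hκ ℓ Xs hℓ' (p - (κ + ℓ)) hp']
      by_cases h3 : p - (κ + ℓ) < κ
      · -- the block right after the first gadget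
        rw [if_pos h3]
        have hr : ℓ ≤ (p - κ) % (ℓ + κ) := by
          rw [Nat.mod_eq_of_lt (by omega)]; omega
        rw [dif_neg (by omega)]
      · rw [if_neg h3]
        have hq : p - κ = (p - (κ + ℓ) - κ) + (ℓ + κ) := by omega
        have hmod : (p - κ) % (ℓ + κ) = (p - (κ + ℓ) - κ) % (ℓ + κ) := by
          rw [hq, Nat.add_mod_right]
        have hdiv : (p - κ) / (ℓ + κ) = (p - (κ + ℓ) - κ) / (ℓ + κ) + 1 := by
          rw [hq, Nat.add_div_right _ (by omega)]
        simp only [hmod, hdiv, List.length_cons, Nat.add_lt_add_iff_right, List.getElem_cons_succ]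

/-! ### Points of the vector gadgets -/

/-- Low parts of the `x`-side vector gadget by position: even positions carry the bit, odd
positions its complement. [folklore] -/
theorem getElem_lowsX : ∀ (a : List Bool) (q : ℕ) (hq : q < (lowsX a).length),
    (lowsX a)[q] = if q % 2 = 0 then xval (a[q / 2]'(by simp at hq; omega))
      else xval (!(a[q / 2]'(by simp at hq; omega)))
  | [], q, hq => by simp [lowsX] at hq
  | α :: a, 0, _ => by simp [lowsX]
  | α :: a, 1, _ => by simp [lowsX]
  | α :: a, q + 2, hq => by
    have hq' : q < (lowsX a).length := by simp [lowsX] at hq ⊢; omega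
    have ih := getElem_lowsX a q hq'
    simp only [lowsX, List.getElem_cons_succ]
    rw [ih]
    have e1 : (q + 2) % 2 = q % 2 := by omega
    have e2 : (q + 2) / 2 = q / 2 + 1 := by omega
    simp only [e1, e2, List.getElem_cons_succ]

/-- Low parts of the `y`-side vector gadget by position: even positions carry the bit, odd
positions the neutral point `2`. [folklore] -/
theorem getElem_lowsY : ∀ (b : List Bool) (q : ℕ) (hq : q < (lowsY b).length),
    (lowsY b)[q] = if q % 2 = 0 then yval (b[q / 2]'(by simp at hq; omega)) else 2
  | [], q, hq => by simp [lowsY] at hq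
  | β :: b, 0, _ => by simp [lowsY]
  | β :: b, 1, _ => by simp [lowsY]
  | β :: b, q + 2, hq => by
    have hq' : q < (lowsY b).length := by simp [lowsY] at hq ⊢; omega
    have ih := getElem_lowsY b q hq'
    simp only [lowsY, List.getElem_cons_succ]
    rw [ih]
    have e1 : (q + 2) % 2 = q % 2 := by omega
    have e2 : (q + 2) / 2 = q / 2 + 1 := by omega
    simp only [e1, e2, List.getElem_cons_succ]

/-- The coordinate value as a natural number: `xvalN 1 = 3`, `xvalN 0 = 1`. [folklore] -/
def xvalN (α : Bool) : ℕ := if α then 3 else 1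
/-- The coordinate value as a natural number: `yvalN 1 = 0`, `yvalN 0 = 2`. [folklore] -/
def yvalN (β : Bool) : ℕ := if β then 0 else 2

/-- `xval` is the cast of `xvalN`. [folklore] -/
@[simp] theorem xval_eq_cast (α : Bool) : xval α = (xvalN α : ℤ) := by cases α <;> rfl
/-- `yval` is the cast of `yvalN`. [folklore] -/
@[simp] theorem yval_eq_cast (β : Bool) : yval β = (yvalN β : ℤ) := by cases β <;> rfl

/-- The value at position `q` of the `x`-side vector gadget (base height `0`) of a vector with
bit function `bit`: `6 q + xvalN (bit (q/2))` at even `q`, `6 q + xvalN ¬(bit (q/2))` at odd `q`.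
[folklore] -/
def vgXval (bit : ℕ → Bool) (q : ℕ) : ℕ :=
  6 * q + (if q % 2 = 0 then xvalN (bit (q / 2)) else xvalN (!bit (q / 2)))

/-- The value at position `q` of the `y`-side vector gadget: `6 q + yvalN (bit (q/2))` at even
`q`, `6 q + 2` at odd `q`. [folklore] -/
def vgYval (bit : ℕ → Bool) (q : ℕ) : ℕ :=
  6 * q + (if q % 2 = 0 then yvalN (bit (q / 2)) else 2)

/-- The points of `vgX 0 a`. [folklore] -/
theorem getElem_vgX (a : List Bool) (q : ℕ) (hq : q < (vgX 0 a).length) :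
    (vgX 0 a)[q] = (vgXval (fun ℓ => a.getD ℓ false) q : ℤ) := by
  unfold vgX at hq ⊢
  rw [getElem_lift hq, getElem_lowsX a q (by simpa using hq)]
  have hl : q / 2 < a.length := by simp at hq; omega
  simp only [vgXval, List.getD_eq_getElem _ _ hl]
  push_cast
  split_ifs <;> simp

/-- The points of `vgY 0 b`. [folklore] -/
theorem getElem_vgY (b : List Bool) (q : ℕ) (hq : q < (vgY 0 b).length) :
    (vgY 0 b)[q] = (vgYval (fun ℓ => b.getD ℓ false) q : ℤ) := by
  unfold vgY at hq ⊢
  rw [getElem_lift hq, getElem_lowsY b q (by simpa using hq)]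
  have hl : q / 2 < b.length := by simp at hq; omega
  simp only [vgYval, List.getD_eq_getElem _ _ hl]
  push_cast
  split_ifs <;> simp

/-! ### Bit access -/

/-- Bit `ℓ` of the extra vector `e = 0^d 1`: `[ℓ = d]` (for any `ℓ`; `false` past the end).
[folklore] -/
theorem eVec_getD (d ℓ : ℕ) : (eVec d).getD ℓ false = decide (ℓ = d) := by
  unfold eVec
  rw [List.getD_eq_getElem?_getD]
  rcases lt_trichotomy ℓ d with h | rfl | h
  · rw [List.getElem?_append_left (by simpa), List.getElem?_replicate]; simp [h, h.ne]
  · rw [List.getElem?_append_right (by simp)]; simp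
  · rw [List.getElem?_eq_none (by simp; omega)]; simp; omega

/-- Total bit access to the first list: `A i ℓ`, `false` out of range. [folklore] -/
def abit (I : OVInstance) (i ℓ : ℕ) : Bool :=
  if h : i < I.n ∧ ℓ < I.d then I.A ⟨i, h.1⟩ ⟨ℓ, h.2⟩ else false

/-- Total bit access to the second list: `B j ℓ`, `false` out of range. [folklore] -/
def bbit (I : OVInstance) (j ℓ : ℕ) : Bool :=
  if h : j < I.n ∧ ℓ < I.d then I.B ⟨j, h.1⟩ ⟨ℓ, h.2⟩ else false

/-- Bits of `aᵢ 0`. [folklore] -/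
theorem extX_aVec_getD (I : OVInstance) (i : Fin I.n) (ℓ : ℕ) :
    (extX (aVec I i)).getD ℓ false = abit I i ℓ := by
  unfold extX aVec abit
  rw [List.getD_eq_getElem?_getD]
  by_cases h : ℓ < I.d
  · rw [List.getElem?_append_left (by simpa), List.getElem?_ofFn]
    simp [h, i.2]
  · rw [List.getElem?_append_right (by simp; omega)]
    simp only [List.length_ofFn]
    rw [dif_neg (by omega)]
    rcases Nat.eq_or_lt_of_le (Nat.not_lt.1 h) with rfl | h'
    · simp
    · rw [List.getElem?_eq_none (by simp; omega)]; rfl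

/-- Bits of `bⱼ 1`: `B j ℓ` for `ℓ < d`, `true` at `ℓ = d`. [folklore] -/
theorem extY_bVec_getD (I : OVInstance) (j : Fin I.n) (ℓ : ℕ) (hℓ : ℓ ≤ I.d) :
    (extY (bVec I j)).getD ℓ false = if ℓ < I.d then bbit I j ℓ else true := by
  unfold extY bVec bbit
  rw [List.getD_eq_getElem?_getD]
  by_cases h : ℓ < I.d
  · rw [List.getElem?_append_left (by simpa), List.getElem?_ofFn]
    simp [h, j.2]
  · have : ℓ = I.d := by omega
    subst this
    rw [List.getElem?_append_right (by simp)]; simp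

/-! ### The two curves in closed form -/

/-- The value (a natural number) of the `x`-side normalised vector gadget of `aᵢ` at offset
`r < ℓx₃`: blocks of `M₁` around the vector gadgets of `e` (inner index `0`) and `aᵢ 0` (inner
index `1`), decoded with `div`/`mod` by `L + κ₁`. [folklore] -/
def nvgXval (I : OVInstance) (i r : ℕ) : ℕ :=
  if r < κ₁ I.d then M₁ I.d else
    if (r - κ₁ I.d) % (Lv I.d + κ₁ I.d) < Lv I.d then
      if (r - κ₁ I.d) / (Lv I.d + κ₁ I.d) = 0 then
        vgXval (fun ℓ => decide (ℓ = I.d)) ((r - κ₁ I.d) % (Lv I.d + κ₁ I.d))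
      else vgXval (abit I i) ((r - κ₁ I.d) % (Lv I.d + κ₁ I.d))
    else M₁ I.d

/-- The value of the `y`-side normalised vector gadget of `bⱼ` at offset `r < ℓy₃`. [folklore] -/
def nvgYval (I : OVInstance) (j r : ℕ) : ℕ :=
  if r < κ₁ I.d then M₁ I.d else
    if (r - κ₁ I.d) % (Lv I.d + κ₁ I.d) < Lv I.d then
      vgYval (fun ℓ => if ℓ < I.d then bbit I j ℓ else true) ((r - κ₁ I.d) % (Lv I.d + κ₁ I.d))
    else M₁ I.d

/-- **The first curve in closed form**: the value of `ovX I` at position `p`. [folklore] -/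
def ovXval (I : OVInstance) (p : ℕ) : ℕ :=
  if p < κ₂ I.d then M₂ I.d else
    if (p - κ₂ I.d) % (ℓx₃ I.d + κ₂ I.d) < ℓx₃ I.d then
      nvgXval I (((p - κ₂ I.d) / (ℓx₃ I.d + κ₂ I.d)) % I.n) ((p - κ₂ I.d) % (ℓx₃ I.d + κ₂ I.d))
    else M₂ I.d

/-- **The second curve in closed form**: the value of `ovY I` at position `q`. [folklore] -/
def ovYval (I : OVInstance) (q : ℕ) : ℕ :=
  if q < κ₂ I.d then M₂ I.d else
    if (q - κ₂ I.d) % (ℓy₃ I.d + κ₂ I.d) < ℓy₃ I.d then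
      nvgYval I ((q - κ₂ I.d) / (ℓy₃ I.d + κ₂ I.d)) ((q - κ₂ I.d) % (ℓy₃ I.d + κ₂ I.d))
    else M₂ I.d

/-- The points of `nvgX` in closed form. [folklore] -/
theorem getElem_nvgX (I : OVInstance) (i : Fin I.n) (r : ℕ) (hr : r < (nvgX I.d (aVec I i)).length) :
    (nvgX I.d (aVec I i))[r] = (nvgXval I i r : ℤ) := by
  have hL : ∀ X ∈ [vgX 0 (eVec I.d), vgX 0 (extX (aVec I i))], X.length = Lv I.d := by
    intro X hX; simp only [List.mem_cons, List.not_mem_nil, or_false] at hX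
    rcases hX with rfl | rfl <;> simp [Lv, dd]
  have hκ1 : 1 ≤ κ₁ I.d := by unfold κ₁; omega
  unfold nvgX at hr ⊢
  rw [getElem_ga _ hκ1 _ _ hL r hr]
  unfold nvgXval
  by_cases h1 : r < κ₁ I.d
  · simp [h1]
  rw [if_neg h1, if_neg h1]
  by_cases h2 : (r - κ₁ I.d) % (Lv I.d + κ₁ I.d) < Lv I.d
  · rw [if_pos h2]
    simp only [h2, true_and, List.length_cons, List.length_nil]
    have hlt2 : (r - κ₁ I.d) / (Lv I.d + κ₁ I.d) < 2 := by
      have hlen : (ga (M₁ I.d : ℤ) (κ₁ I.d) [vgX 0 (eVec I.d), vgX 0 (extX (aVec I i))]).length =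
          κ₁ I.d + 2 * (Lv I.d + κ₁ I.d) := by
        rw [length_ga]; simp [Lv, dd]; ring
      apply Nat.div_lt_of_lt_mul
      omega
    rw [dif_pos hlt2]
    by_cases h3 : (r - κ₁ I.d) / (Lv I.d + κ₁ I.d) = 0
    · simp only [h3, List.getElem_cons_zero, if_true]
      rw [getElem_vgX]
      congr 1; unfold vgXval; simp only [eVec_getD]
    · have h4 : (r - κ₁ I.d) / (Lv I.d + κ₁ I.d) = 1 := by
        generalize (r - κ₁ I.d) / (Lv I.d + κ₁ I.d) = K at hlt2 h3 ⊢; omega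
      simp only [h4, List.getElem_cons_succ, List.getElem_cons_zero, one_ne_zero, if_false]
      rw [getElem_vgX]
      congr 1; unfold vgXval; simp only [extX_aVec_getD]
  · rw [if_neg h2, dif_neg (by tauto)]

/-- The points of `nvgY` in closed form. [folklore] -/
theorem getElem_nvgY (I : OVInstance) (j : Fin I.n) (r : ℕ) (hr : r < (nvgY I.d (bVec I j)).length) :
    (nvgY I.d (bVec I j))[r] = (nvgYval I j r : ℤ) := by
  have hL : ∀ X ∈ [vgY 0 (extY (bVec I j))], X.length = Lv I.d := by
    intro X hX; simp only [List.mem_cons, List.not_mem_nil, or_false] at hX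
    subst hX; simp [Lv, dd]
  have hκ1 : 1 ≤ κ₁ I.d := by unfold κ₁; omega
  unfold nvgY at hr ⊢
  rw [getElem_ga _ hκ1 _ _ hL r hr]
  unfold nvgYval
  by_cases h1 : r < κ₁ I.d
  · simp [h1]
  rw [if_neg h1, if_neg h1]
  by_cases h2 : (r - κ₁ I.d) % (Lv I.d + κ₁ I.d) < Lv I.d
  · rw [if_pos h2]
    simp only [h2, true_and, List.length_cons, List.length_nil]
    have hlt1 : (r - κ₁ I.d) / (Lv I.d + κ₁ I.d) < 1 := by
      have hlen : (ga (M₁ I.d : ℤ) (κ₁ I.d) [vgY 0 (extY (bVec I j))]).length =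
          κ₁ I.d + (Lv I.d + κ₁ I.d) := by
        rw [length_ga]; simp [Lv, dd]
      apply Nat.div_lt_of_lt_mul
      omega
    rw [dif_pos hlt1]
    have h3 : (r - κ₁ I.d) / (Lv I.d + κ₁ I.d) = 0 := by
      generalize (r - κ₁ I.d) / (Lv I.d + κ₁ I.d) = K at hlt1 ⊢; omega
    simp only [h3, List.getElem_cons_zero]
    rw [getElem_vgY]
    congr 1; unfold vgYval
    have hq : (r - κ₁ I.d) % (Lv I.d + κ₁ I.d) / 2 ≤ I.d := by
      have : Lv I.d = 2 * dd I.d := rfl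
      have : dd I.d = I.d + 1 := rfl
      omega
    simp only [extY_bVec_getD I j _ hq]
  · rw [if_neg h2, dif_neg (by tauto)]

/-- **The first curve in closed form.** [folklore] -/
theorem getElem_ovX (I : OVInstance) (p : ℕ) (hp : p < (ovX I).length) :
    (ovX I)[p] = (ovXval I p : ℤ) := by
  have hL : ∀ X ∈ XsOV I, X.length = ℓx₃ I.d := fun X hX => by
    obtain ⟨i, rfl⟩ := mem_XsOV I hX; exact length_nvgX (length_aVec I i)
  have hκ2 : 1 ≤ κ₂ I.d := (params₃ I.d).1
  unfold ovX at hp ⊢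
  rw [getElem_ga _ hκ2 _ _ hL p hp]
  unfold ovXval
  by_cases h1 : p < κ₂ I.d
  · simp [h1]
  rw [if_neg h1, if_neg h1]
  by_cases h2 : (p - κ₂ I.d) % (ℓx₃ I.d + κ₂ I.d) < ℓx₃ I.d
  · have hk : (p - κ₂ I.d) / (ℓx₃ I.d + κ₂ I.d) < (XsOV I).length := by
      rw [length_ga, List.map_congr_left (fun X hX => by rw [hL X hX]), List.map_const',
        List.sum_replicate, smul_eq_mul] at hp
      exact Nat.div_lt_of_lt_mul (by rw [Nat.mul_comm]; omega)
    rw [if_pos h2, dif_pos ⟨h2, hk⟩]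
    simp only [getElem_XsOV]
    rw [getElem_nvgX]; rfl
  · rw [if_neg h2, dif_neg (by tauto)]

/-- **The second curve in closed form.** [folklore] -/
theorem getElem_ovY (I : OVInstance) (q : ℕ) (hq : q < (ovY I).length) :
    (ovY I)[q] = (ovYval I q : ℤ) := by
  have hL : ∀ X ∈ YsOV I, X.length = ℓy₃ I.d := fun X hX => by
    unfold YsOV at hX
    simp only [List.mem_map, List.mem_finRange, true_and] at hX
    obtain ⟨j, rfl⟩ := hX; exact length_nvgY (length_bVec I j)
  have hκ2 : 1 ≤ κ₂ I.d := (params₃ I.d).1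
  unfold ovY at hq ⊢
  rw [getElem_ga _ hκ2 _ _ hL q hq]
  unfold ovYval
  by_cases h1 : q < κ₂ I.d
  · simp [h1]
  rw [if_neg h1, if_neg h1]
  by_cases h2 : (q - κ₂ I.d) % (ℓy₃ I.d + κ₂ I.d) < ℓy₃ I.d
  · have hk : (q - κ₂ I.d) / (ℓy₃ I.d + κ₂ I.d) < (YsOV I).length := by
      rw [length_ga, List.map_congr_left (fun X hX => by rw [hL X hX]), List.map_const',
        List.sum_replicate, smul_eq_mul] at hq
      exact Nat.div_lt_of_lt_mul (by rw [Nat.mul_comm]; omega)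
    rw [if_pos h2, dif_pos ⟨h2, hk⟩]
    simp only [getElem_YsOV]
    rw [getElem_nvgY]
  · rw [if_neg h2, dif_neg (by tauto)]

/-- All closed-form values are at most `M₂`. [folklore] -/
theorem ovXval_le (I : OVInstance) (p : ℕ) (hp : p < (ovX I).length) : ovXval I p ≤ M₂ I.d := by
  have h := (ov_vals I ((ovX I)[p]) (List.mem_append_left _ (List.getElem_mem hp))).2
  rw [getElem_ovX I p hp] at h
  exact Int.ofNat_le.mp h

/-- All closed-form values are at most `M₂`. [folklore] -/
theorem ovYval_le (I : OVInstance) (q : ℕ) (hq : q < (ovY I).length) : ovYval I q ≤ M₂ I.d := by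
  have h := (ov_vals I ((ovY I)[q]) (List.mem_append_right _ (List.getElem_mem hq))).2
  rw [getElem_ovY I q hq] at h
  exact Int.ofNat_le.mp h

/-! ### The emulated input -/

/-- **The emulated input**: the `DTW c` encoding of the instance, `|x| :: encodeIntList (x ++ y)`.
[folklore] -/
def dtwInput (I : OVInstance) : List ℕ := (ovX I).length :: encodeIntList (ovX I ++ ovY I)

/-- The emulated input is the encoding of `ovDTWInst`. [folklore] -/
theorem encode_ovDTWInst_eq {c : ℕ} (hc : 1 ≤ c) (I : OVInstance) :
    (DTW c).encode (ovDTWInst c hc I) = dtwInput I := rfl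

/-- The length of the emulated input: `1 + |x| + |y|`. [folklore] -/
@[simp] theorem length_dtwInput (I : OVInstance) :
    (dtwInput I).length = (ovX I).length + (ovY I).length + 1 := by
  simp [dtwInput]

/-- **The cells of the emulated input**: word `0` is `|x|`, word `1 + p` is `2 · ovXval p` for
`p < |x|`, word `1 + |x| + q` is `2 · ovYval q` for `q < |y|`. [folklore] -/
theorem dtwInput_getD (I : OVInstance) (t : ℕ) :
    (dtwInput I).getD t 0 =
      if t = 0 then (ovX I).length
      else if t - 1 < (ovX I).length then 2 * ovXval I (t - 1)
      else if t - 1 - (ovX I).length < (ovY I).length then 2 * ovYval I (t - 1 - (ovX I).length)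
      else 0 := by
  unfold dtwInput
  rcases Nat.eq_zero_or_pos t with rfl | ht
  · simp
  obtain ⟨s, rfl⟩ := Nat.exists_eq_add_of_le' ht
  rw [if_neg (by omega), Nat.add_sub_cancel, List.getD_cons_succ]
  unfold encodeIntList
  rw [List.getD_eq_getElem?_getD, List.getElem?_map]
  by_cases h1 : s < (ovX I).length
  · rw [if_pos h1, List.getElem?_append_left h1, List.getElem?_eq_getElem h1]
    simp only [Option.map_some, Option.getD_some, getElem_ovX I s h1, encodeInt_natCast]
  · rw [if_neg h1, List.getElem?_append_right (by omega)]
    by_cases h2 : s - (ovX I).length < (ovY I).length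
    · rw [if_pos h2, List.getElem?_eq_getElem h2]
      simp only [Option.map_some, Option.getD_some, getElem_ovY I _ h2, encodeInt_natCast]
    · rw [if_neg h2, List.getElem?_eq_none (by omega)]; rfl

/-- Every word of the emulated input is at most its length. [folklore] -/
theorem dtwInput_le_length (I : OVInstance) : ∀ v ∈ dtwInput I, v ≤ (dtwInput I).length := by
  obtain ⟨-, -, -, hM⟩ := length_ov_bounds I
  obtain ⟨hκ, -, hMκ, -⟩ := params₃ I.d
  have hy : M₂ I.d ≤ (ovY I).length := by rw [length_ovY]; omega
  intro v hv
  rw [length_dtwInput]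
  unfold dtwInput at hv
  rcases List.mem_cons.1 hv with rfl | hv
  · omega
  · unfold encodeIntList at hv
    obtain ⟨w, hw, rfl⟩ := List.mem_map.1 hv
    obtain ⟨h0, hle⟩ := ov_vals I w hw
    obtain ⟨k, rfl⟩ := Int.eq_ofNat_of_zero_le h0
    rw [encodeInt_natCast]
    have hk : k ≤ M₂ I.d := Int.ofNat_le.mp hle
    omega

/-- **The input width of the emulated input** is the bit size of its length (every word is at
most the length), so the emulated word size is `k_D · Nat.size |dtwInput I|`. [folklore] -/
theorem inputWidth_dtwInput (I : OVInstance) : inputWidth (dtwInput I) = Nat.size (dtwInput I).length := by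
  have key : ∀ (l : List ℕ) (B : ℕ), 1 ≤ B → (∀ v ∈ l, v ≤ B) → l.foldr max 1 ≤ B := by
    intro l B hB hl
    induction l with
    | nil => simpa
    | cons v l ih =>
      rw [List.foldr_cons]
      exact max_le (hl v (by simp)) (ih fun w hw => hl w (by simp [hw]))
  have h1 : 1 ≤ (dtwInput I).length := by rw [length_dtwInput]; omega
  have h : (dtwInput I).foldr max 1 ≤ (dtwInput I).length := key _ _ h1 (dtwInput_le_length I)
  unfold inputWidth
  rw [max_eq_left h]

/-- The width of the DTW instance. [folklore] -/
theorem width_ovDTWInst {c : ℕ} (hc : 1 ≤ c) (I : OVInstance) :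
    (DTW c).width (ovDTWInst c hc I) = Nat.size ((ovX I).length + (ovY I).length + 1) := by
  unfold FGProblem.width
  rw [encode_ovDTWInst_eq, inputWidth_dtwInput, length_dtwInput]

end DTWRed

end Literature.Computability.FineGrained
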